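import Mathlib
import Summits.Ventures.HodgeRepro2.Tier7.Line3.LevelPlaceAssembly

/-!
# Tier7/Line3/LocalFactorProduct — the places `≠ v₁`: the product of the local factors has the three `bS` clauses
(seat t7-x1, gen 4; the last «product in words» of the level-place assembly's [W] column)

LINE 3 (t7-plan-3), version (ii). Every consumer of the level-place chain (ConcreteLevelFactor p698828 → … →
LevelPlaceAssembly p706778) takes the places `≠ v₁` as ONE displayed function `bS : Orb → ℂ` with three clauses —
`bS_support : bS γ ≠ 0 → arithS γ`, `bS_bound : arithS γ → ‖bS γ‖ ≤ C (1 + size γ)^ε ‖bS γ₀‖`, `bS_γ₀ : bS γ₀ ≠ 0` —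
and the dictionary says «`bS` = the product over the places `≠ v₁` of the local factors, each with its own three clauses
(`S`: CompactTorusFactorBound p678241 + LocalFactorPositive p664522; split: SplitOrbitBox p670387 + DivisorBound p672115;
inert unramified: `orbital_indicator_one_of_le_of_trivial`), the PRODUCT in words» (ASSEMBLY-p4.md §3, last row). This
module puts the product in the kernel, as pure algebra over a finite index set `T` of places:

* `prodFactor T b γ := ∏ w ∈ T, b w γ`; the joint support is `∀ w ∈ T, arith w γ` (no definition);
* `prodFactor_support` (a product is non-zero only if every factor is), `prodFactor_γ₀` (every factor non-zero at `γ₀`),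
  `prodFactor_bound`: from per-place bounds `‖b w γ‖ ≤ C w (1 + size γ)^(ε w) ‖b w γ₀‖` the
  product satisfies `‖∏ b w γ‖ ≤ (∏ C w) (1 + size γ)^(∑ ε w) ‖∏ b w γ₀‖` (`Finset.prod_le_prod`, `Real.rpow_sum_of_pos`;
  no sign condition on the `C w`, `ε w` is needed — the left-hand factors are norms);
* `levelPlace_assembly_inert_prod`: LevelPlaceAssembly's inert form with `bS := prodFactor T b`, `arithS := (∀ w ∈ T, arith w ·)`,
  `C := ∏ C w`, `ε := ∑ ε w` — the displayed `bS` clauses replaced by the PER-PLACE clauses (support / bound / non-vanishing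
  at `γ₀` for each `w ∈ T`); `hsize : ∀ γ, 0 ≤ size γ` is a NEW displayed clause relative to p706778 (the dictionary's
  `size` is a height, `≥ 0` — identification in words; crit-2 STATUS l. 15947 (2)(i)).

WHAT THIS CHANGES IN THE [W] COLUMN (ASSEMBLY-p4.md §3, last row): «the product of the local factors away from `v₁` with its
support / polynomial bound / non-vanishing at `γ₀` … the product in words» → the product is a theorem; what stays in words is
PER PLACE: at `w ∈ S` the two clauses of CompactTorusFactorBound / LocalFactorPositive, at a split `w` SplitOrbitBox + DivisorBound
(`ε w` = the divisor-bound exponent), at an inert unramified `w` the factor `1` on the support — and the finiteness of the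
set `T` of places where the factor is not identically `1` on the support (the standard normalisation). The exponent
bookkeeping of DominantSideOfKappa (`ε < 1/4`) reads `∑ w ∈ T, ε w < 1/4` on the consumer side (DivisorBound's exponent is
free, so the sum can be made `< 1/4`), as before in words. Nothing here is about (N), (P), the real `X`, or HC_CM; §8(d): NO.
Blind lane: Mathlib + the HodgeRepro2 prefix; no sorry; axioms ⊆ {propext, Classical.choice, Quot.sound}.
-/

namespace Summit.Ventures.HodgeRepro2.Tier7.Line3.LocalFactorProduct

open IsDedekindDomain IsDedekindDomain.HeightOneSpectrum NumberField Matrix MeasureTheory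
  Summit.Ventures.HodgeRepro2.Tier7.Line3.LevelPlaceAssembly
  Summit.Ventures.HodgeRepro2.Tier7.Line3.CongruenceSubgroup
  Summit.Ventures.HodgeRepro2.Tier7.Line3.TorusSupport
  Summit.Ventures.HodgeRepro2.Tier7.Line3.LevelTowerTopology
  Summit.Ventures.HodgeRepro2.Tier7.Line3.LevelFactor
  Summit.Ventures.HodgeRepro2.Tier7.Line3.AdicCompletionLevel
  Summit.Ventures.HodgeRepro2.T7SupportTwoTorusInvariant
  Summit.Ventures.HodgeRepro2.T7SupportRegularStabilizer
open scoped NumberField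

/-! ## The product of local factors over a finite set of places -/

section product

variable {Orb ι : Type*} (T : Finset ι) (b : ι → Orb → ℂ) (arith : ι → Orb → Prop)

/-- the product of the local factors over the places in `T`. -/
noncomputable def prodFactor (γ : Orb) : ℂ := ∏ w ∈ T, b w γ

/-- **support**: the product is non-zero only on the joint support. -/
theorem prodFactor_support (hsupp : ∀ w ∈ T, ∀ γ, b w γ ≠ 0 → arith w γ) :
    ∀ γ, prodFactor T b γ ≠ 0 → ∀ w ∈ T, arith w γ := by
  intro γ hγ w hw
  exact hsupp w hw γ (Finset.prod_ne_zero_iff.1 hγ w hw)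

/-- **non-vanishing at `γ₀`**: every factor non-zero at `γ₀` ⇒ the product is. -/
theorem prodFactor_γ₀ (γ₀ : Orb) (h : ∀ w ∈ T, b w γ₀ ≠ 0) : prodFactor T b γ₀ ≠ 0 :=
  Finset.prod_ne_zero_iff.2 h

/-- **the polynomial bound of the product**: per-place bounds multiply, with the constants multiplied and the exponents
added. -/
theorem prodFactor_bound (γ₀ : Orb) (C ε : ι → ℝ) (size : Orb → ℝ) (hsize : ∀ γ, 0 ≤ size γ)
    (hbound : ∀ w ∈ T, ∀ γ, arith w γ → ‖b w γ‖ ≤ C w * (1 + size γ) ^ ε w * ‖b w γ₀‖) :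
    ∀ γ, (∀ w ∈ T, arith w γ) →
      ‖prodFactor T b γ‖ ≤ (∏ w ∈ T, C w) * (1 + size γ) ^ (∑ w ∈ T, ε w) * ‖prodFactor T b γ₀‖ := by
  intro γ hγ
  have hpos : 0 < 1 + size γ := by linarith [hsize γ]
  simp only [prodFactor, norm_prod]
  rw [Real.rpow_sum_of_pos hpos, ← Finset.prod_mul_distrib, ← Finset.prod_mul_distrib]
  apply Finset.prod_le_prod
  · intro w _
    exact norm_nonneg _
  · intro w hw
    exact hbound w hw γ (hγ w hw)

end product

/-! ## The level-place assembly with the places `≠ v₁` as a product -/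

section assembly

variable {K E : Type*} [Field K] [NumberField K] [Field E] [NumberField E] [Algebra K E]
  (w : HeightOneSpectrum (𝓞 E)) (σ : E ≃ₐ[K] E) (v : HeightOneSpectrum (𝓞 K))
  [w.asIdeal.LiesOver v.asIdeal] (hone : (Ideal.primesOver v.asIdeal (𝓞 E)).ncard = 1)

/-- **LevelPlaceAssembly's inert form with the places `≠ v₁` as a product of local factors** — the three `bS` clauses
are THEOREMS of the per-place clauses (`LocalFactorProduct.prodFactor_support / _bound / _γ₀`); the displayed data away
from `v₁` are now per place: the local factor `b w`, its support `arith w`, its constant `C w` and exponent `ε w`, with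
the three clauses at each `w ∈ T`. -/
theorem levelPlace_assembly_inert_prod
    (f : Fin 2 → Fin 2 → w.adicCompletion E) (P : GL (Fin 2) (w.adicCompletion E))
    (hP : ∀ j, (P : Matrix (Fin 2) (Fin 2) (w.adicCompletion E)).col j = f j)
    (hPint : EntryLE normAbv 1 (P : Matrix (Fin 2) (Fin 2) (w.adicCompletion E)))
    (hPinv : EntryLE normAbv 1 ((P⁻¹ : GL (Fin 2) (w.adicCompletion E)) : Matrix (Fin 2) (Fin 2) (w.adicCompletion E)))
    (χA : torusA (sigmaInert w σ v hone) →* ℂ) (ψB : torusB (sigmaInert w σ v hone) f →* ℂ)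
    (hχc : Continuous χA) (hψc : Continuous ψB)
    (γ₀ : GL (Fin 2) E) (hreg : Regular P (GeneralLinearGroup.map (algebraMap E (w.adicCompletion E)) γ₀))
    (hC : ∀ (z : w.adicCompletion E) (hz : nrm (sigmaInert w σ v hone) z = 1),
      χA (scalarA (sigmaInert w σ v hone) z hz) * ψB (scalarB (sigmaInert w σ v hone) f z hz) = 1)
    {ι : Type*} (T : Finset ι) (b : ι → GL (Fin 2) E → ℂ) (arith : ι → GL (Fin 2) E → Prop)
    (Cw εw : ι → ℝ) (size : GL (Fin 2) E → ℝ) (hsize : ∀ γ, 0 ≤ size γ)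
    (hsupp : ∀ x ∈ T, ∀ γ, b x γ ≠ 0 → arith x γ)
    (hbound : ∀ x ∈ T, ∀ γ, arith x γ → ‖b x γ‖ ≤ Cw x * (1 + size γ) ^ εw x * ‖b x γ₀‖)
    (hγ₀ : ∀ x ∈ T, b x γ₀ ≠ 0) :
    ∃ (mA : MeasurableSpace (torusA (sigmaInert w σ v hone)))
      (mB : MeasurableSpace (torusB (sigmaInert w σ v hone) f))
      (μA : Measure (torusA (sigmaInert w σ v hone))) (μB : Measure (torusB (sigmaInert w σ v hone) f))
      (D : LevelFactorData (torusA (sigmaInert w σ v hone)) (torusB (sigmaInert w σ v hone) f)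
        (GL (Fin 2) (w.adicCompletion E)) (GL (Fin 2) E) μA μB),
      (@BorelSpace (torusA (sigmaInert w σ v hone)) _ mA) ∧
      (@BorelSpace (torusB (sigmaInert w σ v hone) f) _ mB) ∧
      μA.IsHaarMeasure ∧ μB.IsHaarMeasure ∧
      D.ιA = iotaA (sigmaInert w σ v hone) ∧ D.ιB = iotaB (sigmaInert w σ v hone) f ∧
      D.K = levelTower normAbv isNonarchimedean_normAbv (one_lt_q w) ∧
      D.loc = GeneralLinearGroup.map (algebraMap E (w.adicCompletion E)) ∧ D.γ₀ = γ₀ ∧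
      D.arithS = (fun γ => ∀ x ∈ T, arith x γ) ∧ D.bS = prodFactor T b ∧ D.size = size ∧ D.ε = ∑ x ∈ T, εw x ∧
      (∀ N γ, D.b N γ ≠ 0 → D.arith N γ) ∧
      (∃ Bb : ℝ, ∀ N γ, D.arith N γ → ‖D.b N γ‖ ≤ Bb * (1 + D.size γ) ^ D.ε * ‖D.b N D.γ₀‖) ∧
      (∃ N₀ : ℕ, ∀ N ≥ N₀, D.b N D.γ₀ ≠ 0) :=
  levelPlace_assembly_inert w σ v hone f P hP hPint hPinv χA ψB hχc hψc γ₀ hreg hC (fun γ => ∀ x ∈ T, arith x γ)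
    (prodFactor T b) (prodFactor_support T b arith hsupp) (∏ x ∈ T, Cw x) size (∑ x ∈ T, εw x)
    (prodFactor_bound T b arith γ₀ Cw εw size hsize hbound) (prodFactor_γ₀ T b γ₀ hγ₀)

end assembly

end Summit.Ventures.HodgeRepro2.Tier7.Line3.LocalFactorProduct
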